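import Mathlib
import HarnessLib
import Summits.AtomisticToContinuum.BoseEinsteinCondensation.Theorems.NumberPhaseSandwichBumpCalculus

/-! # NumberPhaseSandwich · bump calculus, part 3 of 3 — N-body layer: the dressed pair generator `g = h_c − h_c'`

Helper toward the registered stub `stub_nearPivot_of_kinematic` (crux `FluctuationFloor`, stmt-AtomisticToContinuum-32638, route
NumberPhaseSandwich; decomp-a2c lens-6 g10, LAND ASK-6). Pointwise in the configuration `X`, in the vocabulary of the landed kinematic floor
(`dirVec / G / gradSq / lapG / DPsi` of `NumberPhaseSandwichKinematicCalculus`, imported — not re-declared): `|∇G|²(X) ≥ (4c_σ/ℓ)²·#{p : x_p ∈ shell c}`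
(A-input), `|∇G|²(X) ≤ 3(16C_σ/ℓ)²·N_P(X)` and `‖∇G·∇Ψ‖² ≤ |∇G|²·∑_{p : x_p ∈ P} |∇_pΨ|²` (T-input), `|ΔG(X)| ≤ 3(2C₂/ℓ²)·N_P(X)` (C-input),
`N_P(X) = ∑_p 1_{Q_c ∪ Q_c'}(x_p)`. No sorry. -/

noncomputable section

namespace Summit.AtomisticToContinuum.BoseEinsteinCondensation.Theorems.NumberPhaseSandwichBumpNBody

open Real Set Filter Topology
open Summit.AtomisticToContinuum.BoseEinsteinCondensation.Theorems.NumberPhaseSandwichBumpProfile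
open Summit.AtomisticToContinuum.BoseEinsteinCondensation.Theorems.NumberPhaseSandwichBumpCalculus
open Summit.AtomisticToContinuum.BoseEinsteinCondensation.Theorems.NumberPhaseSandwichKinematicCalculus

section NBody

open Literature.MathematicalPhysics.QuantumManyBody.BoseGas hiding gradSq

variable {N : ℕ} {n : ℕ} {ℓ : ℝ}

/-- the pair generator `g = h_c − h_c'` (the route's `fun x => bump ℓ c x - bump ℓ c' x`). -/
abbrev gpair (ℓ : ℝ) (c c' : SubIdx n) : Space → ℝ := fun y => bump ℓ c y - bump ℓ c' y

/-- indicator of the pair region `P = Q_c ∪ Q_c'` and of the gradient shell of `c`. -/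
abbrev pairInd (ℓ : ℝ) (c c' : SubIdx n) (x : Space) : ℝ := (subCell ℓ c ∪ subCell ℓ c').indicator (fun _ => (1 : ℝ)) x

/-- indicator of the gradient shell of `c`. -/
abbrev shellInd (ℓ : ℝ) (c : SubIdx n) (x : Space) : ℝ := (shell ℓ c).indicator (fun _ => (1 : ℝ)) x

/-- `1_P ≥ 0`. -/
theorem pairInd_nonneg (c c' : SubIdx n) (x : Space) : 0 ≤ pairInd ℓ c c' x :=
  Set.indicator_nonneg (fun _ _ => zero_le_one) x

/-- `1_P² = 1_P`. -/
theorem pairInd_sq (c c' : SubIdx n) (x : Space) : pairInd ℓ c c' x ^ 2 = pairInd ℓ c c' x := by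
  by_cases hx : x ∈ subCell ℓ c ∪ subCell ℓ c'
  · simp [Set.indicator_of_mem hx]
  · simp [Set.indicator_of_notMem hx]

/-- `1_{Q_c} ≤ 1_P`. -/
theorem indicator_left_le_pairInd (c c' : SubIdx n) (x : Space) :
    (subCell ℓ c).indicator (fun _ => (1 : ℝ)) x ≤ pairInd ℓ c c' x :=
  Set.indicator_le_indicator_of_subset Set.subset_union_left (fun _ => zero_le_one) x

/-- `1_{Q_c'} ≤ 1_P`. -/
theorem indicator_right_le_pairInd (c c' : SubIdx n) (x : Space) :
    (subCell ℓ c').indicator (fun _ => (1 : ℝ)) x ≤ pairInd ℓ c c' x :=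
  Set.indicator_le_indicator_of_subset Set.subset_union_right (fun _ => zero_le_one) x

/-- `∂_j g = ∂_j h_c − ∂_j h_c'`. -/
theorem pd_gpair (c c' : SubIdx n) (j : Fin 3) (x : Space) :
    pd (gpair ℓ c c') j x = pd (bump ℓ c) j x - pd (bump ℓ c') j x := by
  simp only [pd]
  rw [fderiv_fun_sub (differentiableAt_bump ℓ c x) (differentiableAt_bump ℓ c' x)]; rfl

/-- `∂_j g = ∂_j h_c − ∂_j h_c'` as functions. -/
theorem pd_gpair_eq (c c' : SubIdx n) (j : Fin 3) :
    pd (gpair ℓ c c') j = fun x => pd (bump ℓ c) j x - pd (bump ℓ c') j x :=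
  funext (pd_gpair c c' j)

/-- `∂_j∂_j g = ∂_j∂_j h_c − ∂_j∂_j h_c'`. -/
theorem pd_pd_gpair (c c' : SubIdx n) (j : Fin 3) (x : Space) :
    pd (pd (gpair ℓ c c') j) j x = pd (pd (bump ℓ c) j) j x - pd (pd (bump ℓ c') j) j x := by
  rw [pd_gpair_eq]
  show fderiv ℝ (fun x => pd (bump ℓ c) j x - pd (bump ℓ c') j x) x (e j) =
    fderiv ℝ (pd (bump ℓ c) j) x (e j) - fderiv ℝ (pd (bump ℓ c') j) x (e j)
  rw [fderiv_fun_sub (differentiableAt_pd_bump c j x) (differentiableAt_pd_bump c' j x)]; rfl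

/-- a global bound of an absolute value is nonnegative. -/
theorem C_nonneg_of_bound {f : ℝ → ℝ} {C : ℝ} (hC : ∀ t : ℝ, |f t| ≤ C) : 0 ≤ C := (abs_nonneg _).trans (hC 0)

/-- `|∂_j g| ≤ (16C_σ/ℓ)·1_P`. -/
theorem abs_pd_gpair_le (hℓ : 0 < ℓ) {C : ℝ} (hC : ∀ x : ℝ, |sigmaDeriv x| ≤ C) (c c' : SubIdx n) (j : Fin 3)
    (x : Space) : |pd (gpair ℓ c c') j x| ≤ 16 * C / ℓ * pairInd ℓ c c' x := by
  rw [pd_gpair]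
  have h1 := abs_pd_bump_le_indicator hℓ hC c j x
  have h2 := abs_pd_bump_le_indicator hℓ hC c' j x
  have i1 := indicator_left_le_pairInd (ℓ := ℓ) c c' x
  have i2 := indicator_right_le_pairInd (ℓ := ℓ) c c' x
  have hCpos : 0 ≤ 8 * C / ℓ := div_nonneg (by linarith [C_nonneg_of_bound hC]) hℓ.le
  calc |pd (bump ℓ c) j x - pd (bump ℓ c') j x| ≤ |pd (bump ℓ c) j x| + |pd (bump ℓ c') j x| := abs_sub _ _
    _ ≤ 8 * C / ℓ * pairInd ℓ c c' x + 8 * C / ℓ * pairInd ℓ c c' x :=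
        add_le_add (h1.trans (mul_le_mul_of_nonneg_left i1 hCpos)) (h2.trans (mul_le_mul_of_nonneg_left i2 hCpos))
    _ = 16 * C / ℓ * pairInd ℓ c c' x := by ring

/-- `|∂_j∂_j g| ≤ (2C₂/ℓ²)·1_P`. -/
theorem abs_pd_pd_gpair_le (hℓ : 0 < ℓ) {C₂ : ℝ} (hC₂ : ∀ t : ℝ, |deriv tauDeriv t| ≤ C₂) (c c' : SubIdx n)
    (j : Fin 3) (x : Space) : |pd (pd (gpair ℓ c c') j) j x| ≤ 2 * C₂ / ℓ ^ 2 * pairInd ℓ c c' x := by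
  rw [pd_pd_gpair]
  have h1 := abs_pd_pd_bump_le_indicator hℓ hC₂ c j x
  have h2 := abs_pd_pd_bump_le_indicator hℓ hC₂ c' j x
  have i1 := indicator_left_le_pairInd (ℓ := ℓ) c c' x
  have i2 := indicator_right_le_pairInd (ℓ := ℓ) c c' x
  have hCpos : 0 ≤ C₂ / ℓ ^ 2 := div_nonneg (C_nonneg_of_bound hC₂) (pow_pos hℓ 2).le
  calc |pd (pd (bump ℓ c) j) j x - pd (pd (bump ℓ c') j) j x|
      ≤ |pd (pd (bump ℓ c) j) j x| + |pd (pd (bump ℓ c') j) j x| := abs_sub _ _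
    _ ≤ C₂ / ℓ ^ 2 * pairInd ℓ c c' x + C₂ / ℓ ^ 2 * pairInd ℓ c c' x :=
        add_le_add (h1.trans (mul_le_mul_of_nonneg_left i1 hCpos)) (h2.trans (mul_le_mul_of_nonneg_left i2 hCpos))
    _ = 2 * C₂ / ℓ ^ 2 * pairInd ℓ c c' x := by ring

/-- **(T-input)** `|∇G|²(X) ≤ 3(16C_σ/ℓ)² · N_P(X)` with `N_P(X) = #{p : x_p ∈ P}`. -/
theorem gradSq_gpair_le (hℓ : 0 < ℓ) {C : ℝ} (hC : ∀ x : ℝ, |sigmaDeriv x| ≤ C) (c c' : SubIdx n)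
    (X : Config N) : gradSq (gpair ℓ c c') X ≤ 3 * (16 * C / ℓ) ^ 2 * ∑ p : Fin N, pairInd ℓ c c' (X p) := by
  unfold gradSq
  rw [Finset.mul_sum]
  refine Finset.sum_le_sum fun p _ => ?_
  have hterm : ∀ j : Fin 3, (pd (gpair ℓ c c') j (X p)) ^ 2 ≤ (16 * C / ℓ) ^ 2 * pairInd ℓ c c' (X p) := by
    intro j
    have h := abs_pd_gpair_le hℓ hC c c' j (X p)
    have hsq : (pd (gpair ℓ c c') j (X p)) ^ 2 ≤ (16 * C / ℓ * pairInd ℓ c c' (X p)) ^ 2 := by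
      rw [← sq_abs]; exact pow_le_pow_left₀ (abs_nonneg _) h 2
    rw [mul_pow, pairInd_sq] at hsq; exact hsq
  calc ∑ j : Fin 3, (pd (gpair ℓ c c') j (X p)) ^ 2 ≤ ∑ j : Fin 3, (16 * C / ℓ) ^ 2 * pairInd ℓ c c' (X p) :=
        Finset.sum_le_sum fun j _ => hterm j
    _ = 3 * (16 * C / ℓ) ^ 2 * pairInd ℓ c c' (X p) := by
        rw [Finset.sum_const, Finset.card_univ, Fintype.card_fin]; simp; ring

/-- **(C-input)** `|ΔG(X)| ≤ 3(2C₂/ℓ²) · N_P(X)`. -/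
theorem abs_lapG_gpair_le (hℓ : 0 < ℓ) {C₂ : ℝ} (hC₂ : ∀ t : ℝ, |deriv tauDeriv t| ≤ C₂) (c c' : SubIdx n)
    (X : Config N) : |lapG (gpair ℓ c c') X| ≤ 3 * (2 * C₂ / ℓ ^ 2) * ∑ p : Fin N, pairInd ℓ c c' (X p) := by
  unfold lapG
  refine (Finset.abs_sum_le_sum_abs _ _).trans ?_
  rw [Finset.mul_sum]
  refine Finset.sum_le_sum fun p _ => ?_
  refine (Finset.abs_sum_le_sum_abs _ _).trans ?_
  calc ∑ j : Fin 3, |pd (pd (gpair ℓ c c') j) j (X p)| ≤ ∑ j : Fin 3, 2 * C₂ / ℓ ^ 2 * pairInd ℓ c c' (X p) :=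
        Finset.sum_le_sum fun j _ => abs_pd_pd_gpair_le hℓ hC₂ c c' j (X p)
    _ = 3 * (2 * C₂ / ℓ ^ 2) * pairInd ℓ c c' (X p) := by
        rw [Finset.sum_const, Finset.card_univ, Fintype.card_fin]; simp; ring

/-- **(A-input, shell floor)** `(4c_σ/ℓ)² · #{p : x_p ∈ shell(c)} ≤ |∇G|²(X)` for sibling (indeed any two distinct) cells. -/
theorem gradSq_gpair_ge (hℓ : 0 < ℓ) {cσ : ℝ} (hcσ0 : 0 ≤ cσ)
    (hcσ : ∀ x ∈ Icc (1 / 4 : ℝ) (3 / 4), cσ ≤ sigmaDeriv x) {c c' : SubIdx n} (hcc : c ≠ c') (X : Config N) :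
    (4 * cσ / ℓ) ^ 2 * ∑ p : Fin N, shellInd ℓ c (X p) ≤ gradSq (gpair ℓ c c') X := by
  unfold gradSq
  rw [Finset.mul_sum]
  refine Finset.sum_le_sum fun p _ => ?_
  have h0 : (pd (gpair ℓ c c') 0 (X p)) ^ 2 ≤ ∑ j : Fin 3, (pd (gpair ℓ c c') j (X p)) ^ 2 :=
    Finset.single_le_sum (f := fun j => (pd (gpair ℓ c c') j (X p)) ^ 2) (fun j _ => sq_nonneg _)
      (Finset.mem_univ 0)
  refine le_trans ?_ h0
  by_cases hx : X p ∈ shell ℓ c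
  · rw [show shellInd ℓ c (X p) = 1 from Set.indicator_of_mem hx _, mul_one]
    exact sq_pd_sub_ge_of_shell hℓ hcσ0 hcσ hcc hx ⟨differentiableAt_bump ℓ c _, differentiableAt_bump ℓ c' _⟩
  · rw [show shellInd ℓ c (X p) = 0 from Set.indicator_of_notMem hx _, mul_zero]; exact sq_nonneg _

/-- **(T-input, Cauchy–Schwarz with support)** `‖∇G·∇Ψ‖² ≤ |∇G|² · ∑_{p : x_p ∈ P} |∇_p Ψ|²`. -/
theorem norm_DPsi_gpair_sq_le (hℓ : 0 < ℓ) {C : ℝ} (hC : ∀ x : ℝ, |sigmaDeriv x| ≤ C) (c c' : SubIdx n)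
    (ψ : Config N → ℂ) (X : Config N) :
    ‖DPsi (gpair ℓ c c') ψ X‖ ^ 2 ≤ gradSq (gpair ℓ c c') X *
      ∑ p : Fin N, pairInd ℓ c c' (X p) * ∑ j : Fin 3, ‖fderiv ℝ ψ X (dirVec p j)‖ ^ 2 := by
  have hsupp : ∀ (p : Fin N) (j : Fin 3),
      pd (gpair ℓ c c') j (X p) = pd (gpair ℓ c c') j (X p) * pairInd ℓ c c' (X p) := by
    intro p j
    by_cases hx : X p ∈ subCell ℓ c ∪ subCell ℓ c'
    · rw [show pairInd ℓ c c' (X p) = 1 from Set.indicator_of_mem hx _, mul_one]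
    · have h := abs_pd_gpair_le hℓ hC c c' j (X p)
      rw [show pairInd ℓ c c' (X p) = 0 from Set.indicator_of_notMem hx _, mul_zero] at h ⊢
      exact abs_nonpos_iff.1 h
  have h1 : ‖DPsi (gpair ℓ c c') ψ X‖ ≤ ∑ p : Fin N, ∑ j : Fin 3,
      |pd (gpair ℓ c c') j (X p)| * (pairInd ℓ c c' (X p) * ‖fderiv ℝ ψ X (dirVec p j)‖) := by
    unfold DPsi
    refine (norm_sum_le _ _).trans (Finset.sum_le_sum fun p _ => (norm_sum_le _ _).trans
      (Finset.sum_le_sum fun j _ => ?_))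
    rw [norm_mul, Complex.norm_real, Real.norm_eq_abs]
    conv_lhs => rw [hsupp p j]
    rw [abs_mul, abs_of_nonneg (pairInd_nonneg c c' (X p)), mul_assoc]
  have h2 : (∑ p : Fin N, ∑ j : Fin 3,
      |pd (gpair ℓ c c') j (X p)| * (pairInd ℓ c c' (X p) * ‖fderiv ℝ ψ X (dirVec p j)‖)) ^ 2 ≤
      (∑ p : Fin N, ∑ j : Fin 3, |pd (gpair ℓ c c') j (X p)| ^ 2) *
        ∑ p : Fin N, ∑ j : Fin 3, (pairInd ℓ c c' (X p) * ‖fderiv ℝ ψ X (dirVec p j)‖) ^ 2 := by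
    have := Finset.sum_mul_sq_le_sq_mul_sq (Finset.univ : Finset (Fin N × Fin 3))
      (fun q => |pd (gpair ℓ c c') q.2 (X q.1)|) (fun q => pairInd ℓ c c' (X q.1) * ‖fderiv ℝ ψ X (dirVec q.1 q.2)‖)
    simpa only [Fintype.sum_prod_type] using this
  have h0 : 0 ≤ ‖DPsi (gpair ℓ c c') ψ X‖ := norm_nonneg _
  calc ‖DPsi (gpair ℓ c c') ψ X‖ ^ 2
      ≤ (∑ p : Fin N, ∑ j : Fin 3,
          |pd (gpair ℓ c c') j (X p)| * (pairInd ℓ c c' (X p) * ‖fderiv ℝ ψ X (dirVec p j)‖)) ^ 2 :=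
        pow_le_pow_left₀ h0 h1 2
    _ ≤ (∑ p : Fin N, ∑ j : Fin 3, |pd (gpair ℓ c c') j (X p)| ^ 2) *
        ∑ p : Fin N, ∑ j : Fin 3, (pairInd ℓ c c' (X p) * ‖fderiv ℝ ψ X (dirVec p j)‖) ^ 2 := h2
    _ = gradSq (gpair ℓ c c') X *
        ∑ p : Fin N, pairInd ℓ c c' (X p) * ∑ j : Fin 3, ‖fderiv ℝ ψ X (dirVec p j)‖ ^ 2 := by
        congr 1
        · unfold gradSq
          exact Finset.sum_congr rfl fun p _ => Finset.sum_congr rfl fun j _ => sq_abs _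
        · refine Finset.sum_congr rfl fun p _ => ?_
          rw [Finset.mul_sum]
          refine Finset.sum_congr rfl fun j _ => ?_
          rw [mul_pow, pairInd_sq]

/-- `g = h_c − h_c'` is `C^∞` (so the kinematic floor applies to it with `hg : ContDiff ℝ 2 g`). -/
theorem contDiff_gpair {m : ℕ∞} (ℓ : ℝ) (c c' : SubIdx n) : ContDiff ℝ m (gpair ℓ c c') :=
  (contDiff_bump ℓ c).sub (contDiff_bump ℓ c')

end NBody

end Summit.AtomisticToContinuum.BoseEinsteinCondensation.Theorems.NumberPhaseSandwichBumpNBody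

end
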